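import Mathlib.Analysis.Normed.Affine.Isometry
import Mathlib.Analysis.Real.Sqrt
import Literature.Geometry.DiscreteGeometry.BondGraph
import Literature.MathematicalPhysics.StatisticalMechanics.BarlowRings
import HarnessLib

/-!
# `ChargedEnergyGap` (stmt-AtomisticToContinuum-14231), line `barlow-relative-pricing`:
# the detection step for an ARBITRARY index type — a site matched to an ideal Barlow chart is
# charge-free

The GEOMETRY step of the line, in the generality needed for the periodic composition
(`ι = Q.points`, the infinite point set of a periodic configuration): the index-generic twin of
`PricedLinkCensusChargedEnergyGapDetect.lean` (there `ι = Fin N`).  Fix a configuration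
`y : ι → ℝ³`, `ι` ANY type, and a site `i` with own nearest-neighbour distance `a = nn_i > 0`
(`Literature.Geometry.DiscreteGeometry.nearestDist`).  Suppose the sites in the ball
`dist (y i) (y j) ≤ 3a` are `a/2`-separated, and that this ball is two-way `a/500`-matched to a
rigid image `g '' barlowStacking a (a√(2/3)) s` of an IDEAL close-packed Barlow stacking (`g` an
affine isometry of `ℝ³`, `s` ANY Hägg sequence): every site of the ball is within `a/500` of some
`g z`, and every stacking point `g z` within `3a` of `y i` is within `a/500` of some site.  Then
`i` is charge-free at tolerance `1/100` (`Literature.Geometry.DiscreteGeometry.IsChargeFree`):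
exactly twelve bonds in the scale-free bond graph `bondGraph (1/100) y`, and ring number `4`
across each of them (`stub_detectNear`).

No finiteness of `ι` is used anywhere: everything `IsChargeFree (1/100) y i` reads lies inside
the `3a`-ball, the own scales are only bounded through `le_nearestDist` / `nearestDist_le_dist`
(never through attainment of the infimum), and the neighbour sets are counted as injective images
(`Set.InjOn.ncard_image`) of the finite sets of touching stacking points.

Proof (the `ε = a/500` perturbation of the `ε = 0` computation for the ideal stacking itself).
Choose matching maps `zOf : sites → stacking` and `jOf : stacking → sites` (hypotheses `hz`, `hj`
below); they are mutually inverse near `i` (`jOf_zOf`, `zOf_jOf`, by the separation clause and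
the packing property `le_dist_of_mem_barlowStacking_ideal`).  The twelve stacking points `w`
touching `zᵢ = zOf i` (`ncard_touching_eq_twelve`) are matched to twelve distinct sites `j_w ≠ i`
with `dist (y i) (y j_w) ≤ 1.004a` (`touching_site`) and `0.996a ≤ nn_{j_w} ≤ 1.004a`
(`le_nearestDist_jOf`: any other site of the ball is matched to a stacking point `≠ w`, at
distance `≥ a`; sites outside the ball are `> 1.996a` away).  Hence `i ∼ j_w`
(`1.004 ≤ 1.01 · 0.996`, `jOf_mem_neighborSet`); conversely a bond `i ∼ j` has `dist ≤ 1.01a`,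
so `zᵢ, z_j` are `< √2·a` apart and touch by the distance gap `eq_or_dist_eq_of_dist_lt`, i.e.
`j = j_w` (`zOf_touching_of_mem`).  So `N(i) = jOf '' {w touching zᵢ}` (`neighborSet_eq`) has
twelve elements; and `j_w ∼ j_{w'}` iff `dist w w' = a` (same gap argument,
`1.01 · 1.004 + 0.004 < 1.41 < √2`), so `N(i) ∩ N(j_w)` is the image of the four common touching
points (`inter_eq`, `ncard_commonTouching_eq_four`), whence `isChargeFree_of_matched`.  The
lemmas are stated for a general scale `a > 0` and layer spacing `h`, `h² = ⅔a²`; the stub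
specialises `a = nn_i`, `h = a√(2/3)`.  All `[folklore]`; proofs adapted verbatim from the
`Fin N` file (namespace `…BarlowRelativePricingDetect`), with `Fin N` replaced by `ι`.
-/

namespace Summit.AtomisticToContinuum.Crystallization.Theorems.BarlowRelativePricingDetectNear

open Literature.MathematicalPhysics.StatisticalMechanics Literature.Geometry.DiscreteGeometry

variable {ι : Type*} {y : ι → EuclideanSpace ℝ (Fin 3)} {i : ι} {a h : ℝ} {s : ℤ → ℤ}
  {g : EuclideanSpace ℝ (Fin 3) ≃ᵃⁱ[ℝ] EuclideanSpace ℝ (Fin 3)}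
  {zOf : ι → EuclideanSpace ℝ (Fin 3)} {jOf : EuclideanSpace ℝ (Fin 3) → ι}

/-! ### Separation and the two round trips of the matching -/

/-- Two sites of the ball `< a/2` apart coincide (the separation clause). [folklore] -/
theorem eq_of_dist_lt_half
    (hsep : ∀ j k : ι, j ≠ k → dist (y i) (y j) ≤ 3 * a → dist (y i) (y k) ≤ 3 * a →
      a / 2 ≤ dist (y j) (y k))
    {j k : ι} (hjb : dist (y i) (y j) ≤ 3 * a) (hkb : dist (y i) (y k) ≤ 3 * a)
    (hlt : dist (y j) (y k) < a / 2) : j = k :=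
  by_contra fun hne => absurd hlt (not_lt.2 (hsep j k hne hjb hkb))

/-- Round trip site → stacking point → site, in the ball of radius `2a`. [folklore] -/
theorem jOf_zOf (ha : 0 < a)
    (hsep : ∀ j k : ι, j ≠ k → dist (y i) (y j) ≤ 3 * a → dist (y i) (y k) ≤ 3 * a →
      a / 2 ≤ dist (y j) (y k))
    (hz : ∀ j : ι, dist (y i) (y j) ≤ 3 * a →
      zOf j ∈ barlowStacking a h s ∧ dist (y j) (g (zOf j)) ≤ 1 / 500 * a)
    (hj : ∀ z ∈ barlowStacking a h s, dist (y i) (g z) ≤ 3 * a →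
      dist (y (jOf z)) (g z) ≤ 1 / 500 * a)
    {j : ι} (hjb : dist (y i) (y j) ≤ 2 * a) : jOf (zOf j) = j := by
  have hj3 : dist (y i) (y j) ≤ 3 * a := by linarith
  obtain ⟨hzS, hzj⟩ := hz j hj3
  have htri := dist_triangle (y i) (y j) (g (zOf j))
  have hk := hj _ hzS (by linarith)
  refine eq_of_dist_lt_half hsep ?_ hj3 ?_
  · have := dist_triangle_right (y i) (y (jOf (zOf j))) (g (zOf j)); linarith
  · have := dist_triangle_right (y (jOf (zOf j))) (y j) (g (zOf j)); linarith

/-- Round trip stacking point → site → stacking point, for stacking points within `2a` of `y i`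
(distinct points of the ideal stacking are `≥ a` apart). [folklore] -/
theorem zOf_jOf (hs : IsHaggSeq s) (ha : 0 < a) (hh : h ^ 2 = 2 / 3 * a ^ 2)
    (hz : ∀ j : ι, dist (y i) (y j) ≤ 3 * a →
      zOf j ∈ barlowStacking a h s ∧ dist (y j) (g (zOf j)) ≤ 1 / 500 * a)
    (hj : ∀ z ∈ barlowStacking a h s, dist (y i) (g z) ≤ 3 * a →
      dist (y (jOf z)) (g z) ≤ 1 / 500 * a)
    {z} (hzS : z ∈ barlowStacking a h s) (hd : dist (y i) (g z) ≤ 2 * a) : zOf (jOf z) = z := by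
  have hjz := hj z hzS (by linarith)
  have hij : dist (y i) (y (jOf z)) ≤ 3 * a := by
    have := dist_triangle_right (y i) (y (jOf z)) (g z); linarith
  obtain ⟨hz'S, hz'⟩ := hz _ hij
  by_contra hne
  have hle := le_dist_of_mem_barlowStacking_ideal hs ha hh hz'S hzS hne
  rw [← g.dist_map] at hle
  have := dist_triangle_left (g (zOf (jOf z))) (g z) (y (jOf z))
  linarith

/-! ### The twelve touching stacking points and their sites -/

/-- For a stacking point `w` touching the centre `zOf i`: `g w` is within `1.002a` of `y i`, its
site `jOf w` is `a/500`-close to `g w`, within `1.004a` of `y i`, and is not `i`. [folklore] -/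
theorem touching_site (ha : 0 < a)
    (hz : ∀ j : ι, dist (y i) (y j) ≤ 3 * a →
      zOf j ∈ barlowStacking a h s ∧ dist (y j) (g (zOf j)) ≤ 1 / 500 * a)
    (hj : ∀ z ∈ barlowStacking a h s, dist (y i) (g z) ≤ 3 * a →
      dist (y (jOf z)) (g z) ≤ 1 / 500 * a)
    {w} (hwS : w ∈ barlowStacking a h s) (hw : dist (zOf i) w = a) :
    dist (y i) (g w) ≤ a + 1 / 500 * a ∧ dist (y (jOf w)) (g w) ≤ 1 / 500 * a ∧
      dist (y i) (y (jOf w)) ≤ (1 + 1 / 250) * a ∧ jOf w ≠ i := by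
  obtain ⟨-, h0⟩ := hz i (by rw [dist_self]; linarith)
  have h1 : dist (y i) (g w) ≤ a + 1 / 500 * a := by
    have := dist_triangle (y i) (g (zOf i)) (g w)
    rw [g.dist_map, hw] at this
    linarith
  have h2 := hj w hwS (by linarith)
  have h3 : dist (y i) (y (jOf w)) ≤ (1 + 1 / 250) * a := by
    have := dist_triangle_right (y i) (y (jOf w)) (g w); linarith
  refine ⟨h1, h2, h3, fun heq => ?_⟩
  rw [heq] at h2
  have := dist_triangle_left (g (zOf i)) (g w) (y i)
  rw [g.dist_map, hw] at this
  linarith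

/-- Touching stacking points are matched injectively. [folklore] -/
theorem injOn_jOf (hs : IsHaggSeq s) (ha : 0 < a) (hh : h ^ 2 = 2 / 3 * a ^ 2)
    (hz : ∀ j : ι, dist (y i) (y j) ≤ 3 * a →
      zOf j ∈ barlowStacking a h s ∧ dist (y j) (g (zOf j)) ≤ 1 / 500 * a)
    (hj : ∀ z ∈ barlowStacking a h s, dist (y i) (g z) ≤ 3 * a →
      dist (y (jOf z)) (g z) ≤ 1 / 500 * a) :
    Set.InjOn jOf {w | w ∈ barlowStacking a h s ∧ dist (zOf i) w = a} := by
  intro w hw w' hw' heq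
  have hb : ∀ {v}, v ∈ barlowStacking a h s → dist (zOf i) v = a → dist (y i) (g v) ≤ 2 * a :=
    fun hvS hv => by linarith [(touching_site ha hz hj hvS hv).1]
  calc w = zOf (jOf w) := (zOf_jOf hs ha hh hz hj hw.1 (hb hw.1 hw.2)).symm
    _ = zOf (jOf w') := by rw [heq]
    _ = w' := zOf_jOf hs ha hh hz hj hw'.1 (hb hw'.1 hw'.2)

/-- Lower scale bound at the site of a touching stacking point: `0.996 a ≤ nn_j` (any other site of
the ball is matched to a stacking point other than `w`, at distance `≥ a` from `w`; sites outside
the ball are far). [folklore] -/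
theorem le_nearestDist_jOf (hs : IsHaggSeq s) (ha : 0 < a) (hh : h ^ 2 = 2 / 3 * a ^ 2)
    (hsep : ∀ j k : ι, j ≠ k → dist (y i) (y j) ≤ 3 * a → dist (y i) (y k) ≤ 3 * a →
      a / 2 ≤ dist (y j) (y k))
    (hz : ∀ j : ι, dist (y i) (y j) ≤ 3 * a →
      zOf j ∈ barlowStacking a h s ∧ dist (y j) (g (zOf j)) ≤ 1 / 500 * a)
    (hj : ∀ z ∈ barlowStacking a h s, dist (y i) (g z) ≤ 3 * a →
      dist (y (jOf z)) (g z) ≤ 1 / 500 * a)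
    {w} (hwS : w ∈ barlowStacking a h s) (hw : dist (zOf i) w = a) :
    (1 - 1 / 250) * a ≤ nearestDist y (jOf w) := by
  obtain ⟨-, hjw, hij, hne⟩ := touching_site ha hz hj hwS hw
  have hjb : dist (y i) (y (jOf w)) ≤ 3 * a := by linarith
  refine le_nearestDist ⟨i, hne.symm⟩ fun k hk => ?_
  by_cases hk3 : dist (y i) (y k) ≤ 3 * a
  · obtain ⟨hzkS, hzk⟩ := hz k hk3
    have hne' : zOf k ≠ w := by
      intro heq
      rw [heq] at hzk
      refine hk (eq_of_dist_lt_half hsep hk3 hjb ?_)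
      have := dist_triangle_right (y k) (y (jOf w)) (g w); linarith
    have hle := le_dist_of_mem_barlowStacking_ideal hs ha hh hzkS hwS hne'
    rw [← g.dist_map] at hle
    have h1 := dist_triangle_left (g (zOf k)) (g w) (y k)
    have h2 := dist_triangle (y k) (y (jOf w)) (g w)
    linarith [dist_comm (y k) (y (jOf w))]
  · push Not at hk3
    have := dist_triangle (y i) (y (jOf w)) (y k); linarith

/-! ### The neighbour set of `i` and the rings (now `a = nn_i`) -/

/-- **The sites of the touching stacking points are bonded to `i`.** [folklore] -/
theorem jOf_mem_neighborSet (hs : IsHaggSeq s) (ha : 0 < a) (hh : h ^ 2 = 2 / 3 * a ^ 2)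
    (hsep : ∀ j k : ι, j ≠ k → dist (y i) (y j) ≤ 3 * a → dist (y i) (y k) ≤ 3 * a →
      a / 2 ≤ dist (y j) (y k))
    (hz : ∀ j : ι, dist (y i) (y j) ≤ 3 * a →
      zOf j ∈ barlowStacking a h s ∧ dist (y j) (g (zOf j)) ≤ 1 / 500 * a)
    (hj : ∀ z ∈ barlowStacking a h s, dist (y i) (g z) ≤ 3 * a →
      dist (y (jOf z)) (g z) ≤ 1 / 500 * a)
    (hnn : nearestDist y i = a) {w} (hwS : w ∈ barlowStacking a h s) (hw : dist (zOf i) w = a) :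
    jOf w ∈ (bondGraph (1 / 100 : ℝ) y).neighborSet i := by
  obtain ⟨-, -, hij, hne⟩ := touching_site ha hz hj hwS hw
  rw [mem_neighborSet_bondGraph, hnn]
  refine ⟨hne.symm, ?_⟩
  have hmin : (1 - 1 / 250) * a ≤ min a (nearestDist y (jOf w)) :=
    le_min (by linarith) (le_nearestDist_jOf hs ha hh hsep hz hj hwS hw)
  linarith

/-- **Conversely, a bond at `i` ends at the site of a touching stacking point**: the stacking point
of `j ∈ N(i)` touches the centre, and `j` is its site. [folklore] -/
theorem zOf_touching_of_mem (hs : IsHaggSeq s) (ha : 0 < a) (hh : h ^ 2 = 2 / 3 * a ^ 2)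
    (hsep : ∀ j k : ι, j ≠ k → dist (y i) (y j) ≤ 3 * a → dist (y i) (y k) ≤ 3 * a →
      a / 2 ≤ dist (y j) (y k))
    (hz : ∀ j : ι, dist (y i) (y j) ≤ 3 * a →
      zOf j ∈ barlowStacking a h s ∧ dist (y j) (g (zOf j)) ≤ 1 / 500 * a)
    (hj : ∀ z ∈ barlowStacking a h s, dist (y i) (g z) ≤ 3 * a →
      dist (y (jOf z)) (g z) ≤ 1 / 500 * a)
    (hnn : nearestDist y i = a) {j : ι}
    (hjN : j ∈ (bondGraph (1 / 100 : ℝ) y).neighborSet i) :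
    (zOf j ∈ barlowStacking a h s ∧ dist (zOf i) (zOf j) = a) ∧ jOf (zOf j) = j := by
  rw [mem_neighborSet_bondGraph, hnn] at hjN
  obtain ⟨hne, hle⟩ := hjN
  have hd : dist (y i) (y j) ≤ (1 + 1 / 100) * a :=
    hle.trans (mul_le_mul_of_nonneg_left (min_le_left _ _) (by norm_num))
  have hib : dist (y i) (y i) ≤ 3 * a := by rw [dist_self]; linarith
  have hj3 : dist (y i) (y j) ≤ 3 * a := by linarith
  obtain ⟨hzS, hzj⟩ := hz j hj3
  obtain ⟨hziS, hzi⟩ := hz i hib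
  refine ⟨⟨hzS, ?_⟩, jOf_zOf ha hsep hz hj (by linarith)⟩
  have hlt : dist (zOf i) (zOf j) < Real.sqrt 2 * a := by
    rw [← g.dist_map]
    have h1 := dist_triangle_left (g (zOf i)) (g (zOf j)) (y i)
    have h2 := dist_triangle (y i) (y j) (g (zOf j))
    have hs2 : (141 / 100 : ℝ) * a < Real.sqrt 2 * a :=
      mul_lt_mul_of_pos_right (Real.lt_sqrt_of_sq_lt (by norm_num)) ha
    linarith
  rcases eq_or_dist_eq_of_dist_lt hs ha hh hziS hzS hlt with heq | hdist
  · refine absurd (eq_of_dist_lt_half hsep hib hj3 ?_) hne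
    rw [heq] at hzi
    have := dist_triangle_right (y i) (y j) (g (zOf j)); linarith
  · exact hdist

/-- **The neighbour set of `i`**: the sites of the twelve touching stacking points. [folklore] -/
theorem neighborSet_eq (hs : IsHaggSeq s) (ha : 0 < a) (hh : h ^ 2 = 2 / 3 * a ^ 2)
    (hsep : ∀ j k : ι, j ≠ k → dist (y i) (y j) ≤ 3 * a → dist (y i) (y k) ≤ 3 * a →
      a / 2 ≤ dist (y j) (y k))
    (hz : ∀ j : ι, dist (y i) (y j) ≤ 3 * a →
      zOf j ∈ barlowStacking a h s ∧ dist (y j) (g (zOf j)) ≤ 1 / 500 * a)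
    (hj : ∀ z ∈ barlowStacking a h s, dist (y i) (g z) ≤ 3 * a →
      dist (y (jOf z)) (g z) ≤ 1 / 500 * a)
    (hnn : nearestDist y i = a) :
    (bondGraph (1 / 100 : ℝ) y).neighborSet i =
      jOf '' {w | w ∈ barlowStacking a h s ∧ dist (zOf i) w = a} := by
  ext j
  refine ⟨fun hjN => ?_, ?_⟩
  · obtain ⟨hT, hjj⟩ := zOf_touching_of_mem hs ha hh hsep hz hj hnn hjN
    exact ⟨zOf j, hT, hjj⟩
  · rintro ⟨w, ⟨hwS, hw⟩, rfl⟩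
    exact jOf_mem_neighborSet hs ha hh hsep hz hj hnn hwS hw

/-- **The common neighbours of `i` and the site of a touching stacking point `w`**: the sites of
the stacking points touching both the centre and `w`. [folklore] -/
theorem inter_eq (hs : IsHaggSeq s) (ha : 0 < a) (hh : h ^ 2 = 2 / 3 * a ^ 2)
    (hsep : ∀ j k : ι, j ≠ k → dist (y i) (y j) ≤ 3 * a → dist (y i) (y k) ≤ 3 * a →
      a / 2 ≤ dist (y j) (y k))
    (hz : ∀ j : ι, dist (y i) (y j) ≤ 3 * a →
      zOf j ∈ barlowStacking a h s ∧ dist (y j) (g (zOf j)) ≤ 1 / 500 * a)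
    (hj : ∀ z ∈ barlowStacking a h s, dist (y i) (g z) ≤ 3 * a →
      dist (y (jOf z)) (g z) ≤ 1 / 500 * a)
    (hnn : nearestDist y i = a) {w} (hwS : w ∈ barlowStacking a h s) (hw : dist (zOf i) w = a) :
    (bondGraph (1 / 100 : ℝ) y).neighborSet i ∩ (bondGraph (1 / 100 : ℝ) y).neighborSet (jOf w) =
      jOf '' {w' | w' ∈ barlowStacking a h s ∧ dist (zOf i) w' = a ∧ dist w w' = a} := by
  obtain ⟨-, hjw, hij, hne⟩ := touching_site ha hz hj hwS hw
  ext k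
  constructor
  · rintro ⟨hki, hkj⟩
    obtain ⟨⟨hzS, hzk⟩, hkk⟩ := zOf_touching_of_mem hs ha hh hsep hz hj hnn hki
    refine ⟨zOf k, ⟨hzS, hzk, ?_⟩, hkk⟩
    rw [mem_neighborSet_bondGraph] at hkj
    obtain ⟨hne', hle⟩ := hkj
    have hnnj : nearestDist y (jOf w) ≤ (1 + 1 / 250) * a := by
      have := nearestDist_le_dist y (j := jOf w) hne.symm
      rw [dist_comm] at this
      linarith
    have hd : dist (y (jOf w)) (y k) ≤ (1 + 1 / 100) * ((1 + 1 / 250) * a) :=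
      hle.trans (mul_le_mul_of_nonneg_left ((min_le_left _ _).trans hnnj) (by norm_num))
    obtain ⟨-, hkz, -⟩ := touching_site ha hz hj hzS hzk
    rw [hkk] at hkz
    have hlt : dist w (zOf k) < Real.sqrt 2 * a := by
      rw [← g.dist_map]
      have h1 := dist_triangle_left (g w) (g (zOf k)) (y (jOf w))
      have h2 := dist_triangle (y (jOf w)) (y k) (g (zOf k))
      have hs2 : (141 / 100 : ℝ) * a < Real.sqrt 2 * a :=
        mul_lt_mul_of_pos_right (Real.lt_sqrt_of_sq_lt (by norm_num)) ha
      linarith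
    rcases eq_or_dist_eq_of_dist_lt hs ha hh hwS hzS hlt with heq | hdist
    · exact absurd (by rw [← hkk, ← heq]) hne'
    · exact hdist
  · rintro ⟨w', ⟨hw'S, hw'1, hw'2⟩, rfl⟩
    refine ⟨jOf_mem_neighborSet hs ha hh hsep hz hj hnn hw'S hw'1, ?_⟩
    rw [mem_neighborSet_bondGraph]
    obtain ⟨-, hjw', -, -⟩ := touching_site ha hz hj hw'S hw'1
    constructor
    · intro heq
      have := injOn_jOf hs ha hh hz hj ⟨hwS, hw⟩ ⟨hw'S, hw'1⟩ heq
      rw [this, dist_self] at hw'2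
      exact ha.ne hw'2
    · have hmin : (1 - 1 / 250) * a ≤ min (nearestDist y (jOf w)) (nearestDist y (jOf w')) :=
        le_min (le_nearestDist_jOf hs ha hh hsep hz hj hwS hw)
          (le_nearestDist_jOf hs ha hh hsep hz hj hw'S hw'1)
      have h1 := dist_triangle (y (jOf w)) (g w) (y (jOf w'))
      have h2 := dist_triangle (g w) (g w') (y (jOf w'))
      rw [g.dist_map, hw'2] at h2
      linarith [dist_comm (g w') (y (jOf w'))]

/-- **A matched site is charge-free at tolerance `1/100`**: twelve bonds (the injective image of
the twelve touching stacking points) and ring number four across each (the image of the four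
common touching points). [folklore] -/
theorem isChargeFree_of_matched (hs : IsHaggSeq s) (ha : 0 < a) (hh : h ^ 2 = 2 / 3 * a ^ 2)
    (hsep : ∀ j k : ι, j ≠ k → dist (y i) (y j) ≤ 3 * a → dist (y i) (y k) ≤ 3 * a →
      a / 2 ≤ dist (y j) (y k))
    (hz : ∀ j : ι, dist (y i) (y j) ≤ 3 * a →
      zOf j ∈ barlowStacking a h s ∧ dist (y j) (g (zOf j)) ≤ 1 / 500 * a)
    (hj : ∀ z ∈ barlowStacking a h s, dist (y i) (g z) ≤ 3 * a →
      dist (y (jOf z)) (g z) ≤ 1 / 500 * a)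
    (hnn : nearestDist y i = a) : IsChargeFree (1 / 100 : ℝ) y i := by
  obtain ⟨hziS, -⟩ := hz i (by rw [dist_self]; linarith)
  have hinj := injOn_jOf hs ha hh hz hj
  refine ⟨?_, fun j hjN => ?_⟩
  · rw [neighborSet_eq hs ha hh hsep hz hj hnn, hinj.ncard_image]
    exact ncard_touching_eq_twelve hs ha hh hziS
  · obtain ⟨⟨hwS, hw⟩, hjj⟩ := zOf_touching_of_mem hs ha hh hsep hz hj hnn hjN
    have hsub : {w' | w' ∈ barlowStacking a h s ∧ dist (zOf i) w' = a ∧ dist (zOf j) w' = a} ⊆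
        {w' | w' ∈ barlowStacking a h s ∧ dist (zOf i) w' = a} :=
      fun w' hw' => ⟨hw'.1, hw'.2.1⟩
    rw [← hjj, ringNumber_def, inter_eq hs ha hh hsep hz hj hnn hwS hw,
      (hinj.mono hsub).ncard_image]
    exact ncard_commonTouching_eq_four hs ha hh hziS hwS hw

/-- **Detection, arbitrary index type** (line `barlow-relative-pricing` of `ChargedEnergyGap`,
stub `stub_detectNear`): a site of a configuration `y : ι → ℝ³` (ANY index type `ι`, e.g. the
point set of a periodic configuration) whose ball of radius `3 · nn_i` is `nn_i / 2`-separated and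
two-way `nn_i / 500`-matched to a rigid image of an ideal close-packed Barlow stacking at scale
`nn_i` (any Hägg sequence) is charge-free at tolerance `1/100` — twelve bonds, ring number four
across each. [folklore] -/
theorem stub_detectNear : ∀ (ι : Type) (y : ι → EuclideanSpace ℝ (Fin 3)) (i : ι), (0 < Literature.Geometry.DiscreteGeometry.nearestDist y i ∧ (∀ j k : ι, j ≠ k → dist (y i) (y j) ≤ 3 * Literature.Geometry.DiscreteGeometry.nearestDist y i → dist (y i) (y k) ≤ 3 * Literature.Geometry.DiscreteGeometry.nearestDist y i → Literature.Geometry.DiscreteGeometry.nearestDist y i / 2 ≤ dist (y j) (y k)) ∧ ∃ (s : ℤ → ℤ) (g : EuclideanSpace ℝ (Fin 3) ≃ᵃⁱ[ℝ] EuclideanSpace ℝ (Fin 3)), Literature.MathematicalPhysics.StatisticalMechanics.IsHaggSeq s ∧ (∀ j : ι, dist (y i) (y j) ≤ 3 * Literature.Geometry.DiscreteGeometry.nearestDist y i → ∃ z ∈ Literature.MathematicalPhysics.StatisticalMechanics.barlowStacking (Literature.Geometry.DiscreteGeometry.nearestDist y i) (Literature.Geometry.DiscreteGeometry.nearestDist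 y i * Real.sqrt (2 / 3)) s, dist (y j) (g z) ≤ (1 / 500 : ℝ) * Literature.Geometry.DiscreteGeometry.nearestDist y i) ∧ (∀ z ∈ Literature.MathematicalPhysics.StatisticalMechanics.barlowStacking (Literature.Geometry.DiscreteGeometry.nearestDist y i) (Literature.Geometry.DiscreteGeometry.nearestDist y i * Real.sqrt (2 / 3)) s, dist (y i) (g z) ≤ 3 * Literature.Geometry.DiscreteGeometry.nearestDist y i → ∃ j : ι, dist (y j) (g z) ≤ (1 / 500 : ℝ) * Literature.Geometry.DiscreteGeometry.nearestDist y i)) → Literature.Geometry.DiscreteGeometry.IsChargeFree (1 / 100 : ℝ) y i := by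
  intro ι y i hyp
  obtain ⟨hpos, hsep, s, g, hs, h₁, h₂⟩ := hyp
  have hh : (nearestDist y i * Real.sqrt (2 / 3)) ^ 2 = 2 / 3 * nearestDist y i ^ 2 := by
    rw [mul_pow, Real.sq_sqrt (by norm_num : (0 : ℝ) ≤ 2 / 3)]; ring
  have h₁' : ∀ j : ι, ∃ z, dist (y i) (y j) ≤ 3 * nearestDist y i →
      z ∈ barlowStacking (nearestDist y i) (nearestDist y i * Real.sqrt (2 / 3)) s ∧
        dist (y j) (g z) ≤ 1 / 500 * nearestDist y i := fun j => by
    by_cases hjb : dist (y i) (y j) ≤ 3 * nearestDist y i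
    · obtain ⟨z, hz, hd⟩ := h₁ j hjb
      exact ⟨z, fun _ => ⟨hz, hd⟩⟩
    · exact ⟨y i, fun h' => absurd h' hjb⟩
  have h₂' : ∀ z, ∃ j : ι,
      z ∈ barlowStacking (nearestDist y i) (nearestDist y i * Real.sqrt (2 / 3)) s →
        dist (y i) (g z) ≤ 3 * nearestDist y i → dist (y j) (g z) ≤ 1 / 500 * nearestDist y i :=
    fun z => by
    by_cases hzb : z ∈ barlowStacking (nearestDist y i) (nearestDist y i * Real.sqrt (2 / 3)) s ∧
        dist (y i) (g z) ≤ 3 * nearestDist y i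
    · obtain ⟨j, hj⟩ := h₂ z hzb.1 hzb.2
      exact ⟨j, fun _ _ => hj⟩
    · exact ⟨i, fun h1 h2 => absurd ⟨h1, h2⟩ hzb⟩
  choose zOf hzOf using h₁'
  choose jOf hjOf using h₂'
  exact isChargeFree_of_matched hs hpos hh hsep hzOf hjOf rfl

end Summit.AtomisticToContinuum.Crystallization.Theorems.BarlowRelativePricingDetectNear
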